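import Summits.ValiantsHypothesis.ValiantsHypothesis.Theorems.LacunarySymmetroidMatrixDescartesDoorA26WallBubblingScalingLimit
import Summits.ValiantsHypothesis.ValiantsHypothesis.Theorems.LacunarySymmetroidMatrixDescartesDoorA26WallBubblingEventualSigns

/-!
# `DoorA26` / line `wall_bubbling` — LOCAL OPENINGS: counting zeros interval by interval (the frame-free lift format)

HONEST FRAMING.  Object-search cell `pub-symmetroid`, crux `Theses.LacunarySymmetroid.DoorA26` (stmt-ValiantsHypothesis-19979; OPEN, typed,
never asserted).  W2 seat val-sym-door-p1 g20, file #78; def-free helper for obligation (R) of `Cruxes/DoorA26/Lines/wall_bubbling.lean`.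

WHY.  Every lift of a multiplicity profile in the tree (#43–#50, #57, #62/#63, #69–#75) ends in ONE global frame of 21 increasing abscissae with
alternating signs (`le_ncard_of_alternations_exp`, #69 `mem_twentyLocus_of_eventually_alternating`); each new multiplicity pattern then needs its
own frame file (#71 `…InsertThree`, #73 `…InsertTwo`).  For the ORDER ≥ 3 programme of memo `DOOR-A26-P1G19-NO-BALANCE.md` §7 (zeros of any
order, several of them, opened at different scales `η^α`) the global frame is the wrong currency.  This file counts LOCALLY instead: a zero of order
`m` of the limit determinant, opened by a family `Sη η` into `m` simple zeros, is witnessed by `m + 1` abscissae of alternating sign INSIDE a small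
interval around it; zeros found in pairwise disjoint intervals are distinct; `Σ_j m_j ≥ 20` of them put `δ` in the twenty-locus.  No ordering of the
groups among each other, no global sign pattern, no parity bookkeeping across gaps — only the order of the INTERVALS.

WHAT IS HERE.  `exists_zeros_of_alternations_in` (IVT, group by group); `le_ncard_of_separated_zeros` (zeros sorted inside pairwise disjoint
ordered intervals are distinct: `Σ_j m_j ≤ ncard`); ★ `le_ncard_of_local_alternations` (static: local alternating groups ⇒ finite zero set with
`≥ Σ m_j` elements) and `mem_twentyLocus_of_local_alternations`; ★★ `mem_twentyLocus_of_local_openings` (EVENTUAL version for a family of letters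
`Sη η` and abscissa families `t j η i` moving with `η`: each group eventually increasing, eventually inside its interval, eventually of alternating
sign ⇒ `δ ∈ TwentyLocus`) — the format every Newton-polygon opening (#70 `eventually_kappa_pos_scaling`) feeds, zero by zero.
Nothing here bears on `DoorA26`, `DoorA34`, (W)/(M)/(R), `MatrixDescartes` (18050) or `VP ≠ VNP`; registers unchanged.

[folklore] intermediate value theorem; finite intersections of eventualities.  [this work] the packaging.
-/

set_option linter.dupNamespace false

namespace Summit.ValiantsHypothesis.ValiantsHypothesis.Theorems.LacunarySymmetroidMatrixDescartes.WallBubbling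

open Finset Filter Topology
open Bubbling (TwentyLocus)
open Census.RealExp (ncard_rpow_eq_ncard_exp exists_zero_of_mul_neg continuous_det_expPencil le_ncard_of_brackets)

/-! ## §1 One group: alternating signs at `m + 1` increasing abscissae inside `[a, b]` give `m` sorted zeros in `(a, b)` -/

/-- **IVT, group form.**  `m + 1` increasing abscissae `t 0 < ⋯ < t m` in `[a, b]` with `det`-values of alternating sign yield `m` strictly increasing
zeros of `t ↦ det Σ e^{δ_l t} S_l` in `(a, b)` (one in each gap). [folklore] -/
theorem exists_zeros_of_alternations_in (δ : Fin 6 → ℝ) (S : Fin 6 → Matrix (Fin 2) (Fin 2) ℝ) {m : ℕ}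
    (t : Fin (m + 1) → ℝ) (ht : StrictMono t) {a b : ℝ} (ha : a ≤ t 0) (hb : t (Fin.last m) ≤ b)
    (halt : ∀ i : Fin m, (∑ l, Real.exp (δ l * t i.castSucc) • S l).det * (∑ l, Real.exp (δ l * t i.succ) • S l).det < 0) :
    ∃ w : Fin m → ℝ, StrictMono w ∧ ∀ i, w i ∈ Set.Ioo a b ∧ (∑ l, Real.exp (δ l * w i) • S l).det = 0 := by
  have hzeros : ∀ i : Fin m, ∃ w ∈ Set.Ioo (t i.castSucc) (t i.succ), (∑ l, Real.exp (δ l * w) • S l).det = 0 :=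
    fun i => exists_zero_of_mul_neg (ht (Fin.castSucc_lt_succ (i := i))) (continuous_det_expPencil δ S).continuousOn (halt i)
  choose w hwmem hw0 using hzeros
  have hwmono : StrictMono w := by
    intro i j hij
    have h1 := (hwmem i).2
    have h2 := (hwmem j).1
    have h3 : t i.succ ≤ t j.castSucc := ht.monotone (by
      rw [Fin.le_def, Fin.val_succ, Fin.val_castSucc]; exact hij)
    linarith
  refine ⟨w, hwmono, fun i => ⟨⟨?_, ?_⟩, hw0 i⟩⟩
  · have h0 : t 0 ≤ t i.castSucc := ht.monotone (Fin.zero_le _)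
    linarith [(hwmem i).1]
  · have h1 : t i.succ ≤ t (Fin.last m) := ht.monotone (Fin.le_last _)
    linarith [(hwmem i).2]

/-! ## §2 Several groups: zeros sorted inside pairwise disjoint ordered intervals are distinct -/

/-- **Separated families of zeros are distinct.**  A finite set `Z`, intervals `(a j, b j)` with `b i ≤ a j` for `i < j`, and in each a strictly
increasing family of `m j` elements of `Z` ⇒ `Σ_j m j ≤ ncard Z`. [folklore] -/
theorem le_ncard_of_separated_zeros {Z : Set ℝ} (hZ : Z.Finite) {r : ℕ} (a b : Fin r → ℝ) (hdisj : ∀ i j : Fin r, i < j → b i ≤ a j)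
    (m : Fin r → ℕ) (w : (j : Fin r) → Fin (m j) → ℝ) (hw : ∀ j, StrictMono (w j))
    (hmem : ∀ j i, w j i ∈ Set.Ioo (a j) (b j)) (hZw : ∀ j i, w j i ∈ Z) :
    ∑ j, m j ≤ Z.ncard := by
  classical
  -- the map `(j, i) ↦ w j i` is injective
  let W : (Σ j : Fin r, Fin (m j)) → ℝ := fun p => w p.1 p.2
  have hinj : Function.Injective W := by
    rintro ⟨j, i⟩ ⟨j', i'⟩ h
    change w j i = w j' i' at h
    rcases lt_trichotomy j j' with hjj | rfl | hjj
    · exfalso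
      have h1 := (hmem j i).2
      have h2 := (hmem j' i').1
      have h3 := hdisj j j' hjj
      linarith
    · have : i = i' := (hw j).injective h
      subst this; rfl
    · exfalso
      have h1 := (hmem j' i').2
      have h2 := (hmem j i).1
      have h3 := hdisj j' j hjj
      linarith
  have hsub : Set.range W ⊆ Z := by
    rintro _ ⟨⟨j, i⟩, rfl⟩; exact hZw j i
  have h1 := Set.ncard_le_ncard hsub hZ
  rw [Set.ncard_range_of_injective hinj, Nat.card_eq_fintype_card, Fintype.card_sigma] at h1
  simpa only [Fintype.card_fin] using h1

/-! ## §3 Static local format: alternating groups in disjoint intervals ⇒ `Σ m_j` zeros ⇒ `TwentyLocus` -/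

/-- ★ **LOCAL ALTERNATIONS ⇒ COUNT.**  Groups `j : Fin r` of `m j + 1` increasing abscissae `t j 0 < ⋯ < t j (m j)` inside `[a j, b j]`, the intervals
ordered and disjoint (`b i ≤ a j` for `i < j`), `det` alternating in sign along each group, and at least one group non-trivial (`0 < Σ m j`) ⇒ the zero
set of `t ↦ det Σ e^{δ_l t} S_l` is finite with at least `Σ_j m j` elements. [this work] -/
theorem le_ncard_of_local_alternations (δ : Fin 6 → ℝ) (S : Fin 6 → Matrix (Fin 2) (Fin 2) ℝ) {r : ℕ}
    (a b : Fin r → ℝ) (hdisj : ∀ i j : Fin r, i < j → b i ≤ a j) (m : Fin r → ℕ) (hm : 0 < ∑ j, m j)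
    (t : (j : Fin r) → Fin (m j + 1) → ℝ) (ht : ∀ j, StrictMono (t j))
    (hin : ∀ j, a j ≤ t j 0 ∧ t j (Fin.last (m j)) ≤ b j)
    (halt : ∀ j (i : Fin (m j)), (∑ l, Real.exp (δ l * t j i.castSucc) • S l).det *
      (∑ l, Real.exp (δ l * t j i.succ) • S l).det < 0) :
    {x : ℝ | (∑ l, Real.exp (δ l * x) • S l).det = 0}.Finite ∧
      ∑ j, m j ≤ {x : ℝ | (∑ l, Real.exp (δ l * x) • S l).det = 0}.ncard := by
  classical
  -- finiteness from one bracket of a non-trivial group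
  have hex : ∃ j, 0 < m j := by
    by_contra h
    push Not at h
    have : ∑ j, m j = 0 := Finset.sum_eq_zero fun j _ => Nat.le_zero.1 (h j)
    omega
  obtain ⟨j₀, hj₀⟩ := hex
  have hfin : {x : ℝ | (∑ l, Real.exp (δ l * x) • S l).det = 0}.Finite := by
    let i₀ : Fin (m j₀) := ⟨0, hj₀⟩
    exact (le_ncard_of_brackets (m := 2) (K := 6) δ S (n := 1) Nat.one_pos
      (a := fun _ => t j₀ i₀.castSucc) (b := fun _ => t j₀ i₀.succ)
      (fun _ => ht j₀ Fin.castSucc_lt_succ) (fun i j hij => absurd hij (by omega)) (fun _ => halt j₀ i₀)).1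
  refine ⟨hfin, ?_⟩
  -- sorted zeros in each interval
  have hw : ∀ j, ∃ w : Fin (m j) → ℝ, StrictMono w ∧ ∀ i, w i ∈ Set.Ioo (a j) (b j) ∧
      (∑ l, Real.exp (δ l * w i) • S l).det = 0 :=
    fun j => exists_zeros_of_alternations_in δ S (t j) (ht j) (hin j).1 (hin j).2 (halt j)
  choose w hwmono hwprop using hw
  exact le_ncard_of_separated_zeros hfin a b hdisj m w hwmono (fun j i => (hwprop j i).1) (fun j i => (hwprop j i).2)

/-- **LOCAL ALTERNATIONS ⇒ TWENTY-LOCUS** (static).  Symmetric letters and local alternating groups as in `le_ncard_of_local_alternations` with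
`Σ_j m j ≥ 20` ⇒ `δ ∈ TwentyLocus`. [this work] -/
theorem mem_twentyLocus_of_local_alternations (δ : Fin 6 → ℝ) (S : Fin 6 → Matrix (Fin 2) (Fin 2) ℝ) (hS : ∀ l, (S l).IsSymm) {r : ℕ}
    (a b : Fin r → ℝ) (hdisj : ∀ i j : Fin r, i < j → b i ≤ a j) (m : Fin r → ℕ) (hm : 20 ≤ ∑ j, m j)
    (t : (j : Fin r) → Fin (m j + 1) → ℝ) (ht : ∀ j, StrictMono (t j))
    (hin : ∀ j, a j ≤ t j 0 ∧ t j (Fin.last (m j)) ≤ b j)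
    (halt : ∀ j (i : Fin (m j)), (∑ l, Real.exp (δ l * t j i.castSucc) • S l).det *
      (∑ l, Real.exp (δ l * t j i.succ) • S l).det < 0) :
    δ ∈ TwentyLocus := by
  have h := (le_ncard_of_local_alternations δ S a b hdisj m (by omega) t ht hin halt).2
  refine ⟨S, hS, ?_⟩
  rw [ncard_rpow_eq_ncard_exp]
  exact hm.trans h

/-! ## §4 Eventual local format: groups of abscissae moving with `η` -/

/-- ★★ **LOCAL OPENINGS ⇒ TWENTY-LOCUS** (eventual, abscissae moving with the parameter).  A family of symmetric letters `Sη η`; groups `j : Fin r`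
with target multiplicities `m j`, `Σ_j m j ≥ 20`; pairwise disjoint ordered intervals `[a j, b j]`; for each group a family of `m j + 1` abscissae
`t j η`, eventually (as `η → 0⁺`) strictly increasing and eventually inside `[a j, b j]`; target signs `κ j i` alternating along each group and attained
eventually at each abscissa.  Then `δ ∈ TwentyLocus` (one small `η` realises everything; `le_ncard_of_local_alternations`).  This is the format fed,
zero by zero, by the Newton-polygon openings of #70 (`eventually_kappa_pos_scaling` at `t⋆ + η^α σ`). [this work] -/
theorem mem_twentyLocus_of_local_openings (δ : Fin 6 → ℝ) (Sη : ℝ → Fin 6 → Matrix (Fin 2) (Fin 2) ℝ) (hS : ∀ η l, (Sη η l).IsSymm)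
    {r : ℕ} (a b : Fin r → ℝ) (hdisj : ∀ i j : Fin r, i < j → b i ≤ a j) (m : Fin r → ℕ) (hm : 20 ≤ ∑ j, m j)
    (t : (j : Fin r) → ℝ → Fin (m j + 1) → ℝ) (hmono : ∀ j, ∀ᶠ η in 𝓝[>] (0 : ℝ), StrictMono (t j η))
    (hin : ∀ j, ∀ᶠ η in 𝓝[>] (0 : ℝ), a j ≤ t j η 0 ∧ t j η (Fin.last (m j)) ≤ b j)
    (κ : (j : Fin r) → Fin (m j + 1) → ℝ) (halt : ∀ j (i : Fin (m j)), κ j i.castSucc * κ j i.succ < 0)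
    (hsign : ∀ j i, ∀ᶠ η in 𝓝[>] (0 : ℝ), 0 < κ j i * (∑ l, Real.exp (δ l * t j η i) • Sη η l).det) :
    δ ∈ TwentyLocus := by
  -- gather the finitely many eventualities
  have h1 : ∀ᶠ η in 𝓝[>] (0 : ℝ), ∀ j, StrictMono (t j η) := eventually_all.2 hmono
  have h2 : ∀ᶠ η in 𝓝[>] (0 : ℝ), ∀ j, a j ≤ t j η 0 ∧ t j η (Fin.last (m j)) ≤ b j := eventually_all.2 hin
  have h3 : ∀ᶠ η in 𝓝[>] (0 : ℝ), ∀ p : (Σ j : Fin r, Fin (m j + 1)),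
      0 < κ p.1 p.2 * (∑ l, Real.exp (δ l * t p.1 η p.2) • Sη η l).det :=
    eventually_all.2 fun p => hsign p.1 p.2
  obtain ⟨η, ⟨hη1, hη2⟩, hη3⟩ := ((h1.and h2).and h3).exists
  refine mem_twentyLocus_of_local_alternations δ (Sη η) (hS η) a b hdisj m hm (fun j => t j η) hη1 hη2 ?_
  intro j i
  exact mul_neg_of_kappa_signs (hη3 ⟨j, i.castSucc⟩) (hη3 ⟨j, i.succ⟩) (halt j i)

end Summit.ValiantsHypothesis.ValiantsHypothesis.Theorems.LacunarySymmetroidMatrixDescartes.WallBubbling
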